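import Summits.QuantumFields.BalabanUV.Beta.D1BFx.GhostBubbleRest
import Summits.QuantumFields.BalabanUV.Beta.D1BFx.SplitRecut

/-!
# `BalabanUV.Beta.D1BFx.GhostBubbleRestFrozen` — road «BF-x» for binder row D1, slot (REST′), the ghost bubble range AT THE ROAD'S FROZEN PROFILE OF
# RECORD: the fifteen words `restK' … (gfrz n a b) … (gbub x)` of the re-cut END `RoadEndBFxRecut.d1Drift_BFx_recut` (p224363), bounded at every block size from an
# EXPLICIT (α)-leaf `Decays (Ga n a) CG δG`, a rate choice and ONE displayed inequality — `GhostBubbleRest` (p223624) instantiated at `gp := gfrz n a`, nothing else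

HONEST DEPENDENCY (page 1, mandatory): continuum YM on T⁴ ⇐ BetaPertH ∧ nine spine estimates (0/9 proved); BetaPertH ⇐ (D1) ∧ (D4) ∧
CAP+tail; G-an2-4 gates asym, D1 and NE2/3/4.  HONEST FRAMING (cell contract, verbatim): «discharging `BetaPertH` makes Bałaban's UV
stability UNCONDITIONAL — a real constructive-QFT result; it is NOT the continuum limit and NOT the Clay problem.»  THIS MODULE DISCHARGES
NOTHING of the wall: [folklore] bookkeeping BY NAME over `GhostBubbleRest.abs_avg_fullSum_restK_gbub_le` (this lineage, p223624), leaf-03-g3's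
`FrozenLegProfile.gfrz`∕`gfrz_eq_avg64`∕`abs_avg64_le`∕`decay_gProf` (p221057) and the owner's `SplitRecut.restK'_gbub_eq` (p223937: on the ghost bubble range the
re-cut table IS the raw one).  No `def`, no `Prop` minted, nothing printed asserted, no citation, 0 sorry.  The (α)-leaf `Decays (Ga n a) CG δG` (B5 Prop. 1.2
content — `GluonLeg`'s header: NOT derivable from the tree today) is a displayed HYPOTHESIS with explicit constants, exactly as the road's T7∕A-leaves take it;
the displayed weight inequality is asserted nowhere.  0 wall binders; NOT the A3-gh bound, NOT the (K) slot, NOT D1, NOT `BetaPertH`, NOT continuum, NOT Clay.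

ABSOLUTE RULE (cell charter, verbatim): «No internally-minted statement may enter as a cited fact. Every hypothesis is either kernel-proved in
this package or a verbatim quotation of a PUBLISHED theorem with page reference. The manuscript(s) under audit are NOT citable for their own
disputed steps — they are the thing under adjudication; programme-internal (2001/route/tribunal) claims are never citable.»

WHY (owner d1-p2-g3, RESHAPE «D1-BFx-LON-MISCUT» + INTEGRATION #8, journal l.16536).  The road's END of record is now `RoadEndBFxRecut.d1Drift_BFx_recut`: the
frozen profile is no longer a free parameter `gp n b` but the road's `gfrz n a b` (R-10′), the normalisation is pinned `lam n = n⁸`, and the per-word (REST′)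
hypothesis reads, for every `n ≥ 2` and every `τ ≠ cornerIdx`,
`|Σ_{b ∈ image resSite} n⁻⁴·fullSum (w ↦ restK' n a (gfrz n a b) … (ω_gl n) (ω_gh n) (n⁸) N μ ν b τ w)| ≤ CR τ`.
For the ghost bubble range `τ = Sum.inr (Sum.inr (Sum.inr (Sum.inl x)))` the re-cut table is the raw one (`restK'_gbub_eq`, definitional), the words do not see
`lam`, and `GhostBubbleRest.abs_avg_fullSum_restK_gbub_le` bounds the base-point average at fixed `n` for ANY site-dependent profile with ONE exponential bound
`(Cg, δg)`; the frozen profile has such a bound with `(Cg, δg) := (CG, δG)` as soon as the gluon leg decays with EXPLICIT constants, `Decays (Ga n a) CG δG`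
(`decay_gProf`: each of the 64 symmetrised diagonal profiles inherits the leg's bound; `abs_avg64_le`: so does their average).  So the gbub slots of the new END are
served by: the explicit (α)-leaf, a rate `0 < δ ≤ δ_u(4,a)∕4` with `δ∕n ≤ δG`, and the displayed inequality of `GhostBubbleRest` with `Cg := CG` — whose
n-uniformity remains the A3-gh content, NOT proved (see `GhostBubbleRest`'s header: polynomially n-dependent in this currency; with `lam = n⁸` the weight
prefactor `|ω_gh|·|ghWt i|·|ghWt j|·n⁻⁸` is `4N²·|cQ∕cK|^{#Q}` by `hω`∕`hlam`, so the n-dependence sits in `T_bub n` and `betaPrime510` only).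
* §1 `abs_gfrz_le_of_decays` (the frozen profile's exponential bound from an explicit leg decay, uniform in the base site).
* §2 **`abs_avg_fullSum_restK'_gbub_gfrz_le`** (fixed `n`: the (REST′) gbub slice of `AssemblyEndRecut.defect_le_at_recut` ∕ `RoadEndBFxRecut` at `gfrz`, any `lam`).
* §3 **`hRest_gbub_recut`** (∀ `n ≥ 2`: LITERALLY the `τ = gbub x` slice of `d1Drift_BFx_recut`'s `hRest`, from `0 < a`, `∀ n ≥ 2, Decays (Ga n a) (CG n) (δG n)`, rates
  `δ n`, and the displayed `hCR`).
* §4 `ghWeight_eq_of_hω_hlam` (`|ω_gh|·|cK|·|cK|·n⁻⁸ = 4N²` under the END's `hω`∕`hlam` — the weight prefactor of the displayed inequality is n-free).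
Unit `b2b-balaban-gan24-formalise-leaf-05` (gen 32; cross-lane idle G-an2-4 leaf seat), `LEAVES-BFx.md` row (REST′) gbub (sub-leaf «D1-BFx-REST-gbub», frozen-profile member).
-/

noncomputable section

namespace Summit.QuantumFields.BalabanUV.Beta.D1BFx.GhostBubbleRestFrozen

open Finset
open scoped BigOperators
open Literature.MathematicalPhysics.QuantumFieldTheory.Balaban1983to89
open Literature.MathematicalPhysics.QuantumFieldTheory.Balaban1983to89.Beta
open B12Sec2to5 (l1 betaPrime510)
open B6QGQDecay237 (deltaU)
open ExpKernelCalculus (Decays Zl)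
open WindowIdentification (fullSum)
open DyadicShell (Pt)
open DressedMomentNormalisation (resSite)
open Summit.QuantumFields.BalabanUV.Beta.D1BFx.GluonLeg (Ga)
open Summit.QuantumFields.BalabanUV.Beta.D1BFx.ReducedKernel (TableR)
open Summit.QuantumFields.BalabanUV.Beta.D1BFx.FineHessianGhostGrades (ghWt)
open Summit.QuantumFields.BalabanUV.Beta.D1BFx.FrozenLegProfile (gfrz gfrz_eq_avg64 abs_avg64_le decay_gProf)
open Summit.QuantumFields.BalabanUV.Beta.D1BFx.SplitRecut (restK' restK'_gbub_eq)
open Summit.QuantumFields.BalabanUV.Beta.D1BFx.GhostBubbleRest (abs_avg_fullSum_restK_gbub_le)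

/-! ## §1 The frozen profile's exponential bound from an explicit leg decay -/

section Profile

variable (n : ℕ) [NeZero n] (a : ℝ) {CG δG : ℝ}

/-- [folklore] **THE FROZEN PROFILE INHERITS THE LEG'S EXPLICIT DECAY, UNIFORMLY IN THE BASE SITE**: `Decays (Ga n a) CG δG` ⟹
`|gfrz n a b v| ≤ CG·e^{−δG|v|₁}` for every `b`, `v` (leaf-03-g3's `decay_gProf` on each of the 64 symmetrised diagonal profiles + convexity `abs_avg64_le`;
cf. `FrozenLegProfile.decay_gfrz`, the ∃-form from `Spr (Ga n a)`). -/
theorem abs_gfrz_le_of_decays (hGa : Decays (Ga n a) CG δG) (b v : Pt) : |gfrz n a b v| ≤ CG * Real.exp (-δG * l1 v) := by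
  rw [gfrz_eq_avg64]
  exact abs_avg64_le fun ε κ => decay_gProf (n := n) (a := a) (b := b) hGa ε κ v

end Profile

/-! ## §2 The ghost bubble words of the re-cut table at the frozen profile, fixed block size -/

section Fixed

variable (n : ℕ) [NeZero n] (a : ℝ) (cE cΛ cR cK cQ cE₂ cJ4 cΛ₂ cR₂ cQ₂ x₀ : ℝ) (WE WJ WΛ WR WQ : TableR) (ωgl ωgh lam N : ℝ) (μ ν : Fin 4)
  {CG δG δ : ℝ}

/-- [folklore] **THE (REST′) gbub SLICE AT THE FROZEN PROFILE, FIXED `n`** (any normalisation `lam` — the ghost bubble words do not see it): `0 < a`, an explicit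
(α)-leaf `Decays (Ga n a) CG δG`, a rate `0 < δ ≤ δ_u(4,a)∕4` with `δ∕n ≤ δG` ⟹
`|Σ_{b ∈ image resSite} n⁻⁴·fullSum (w ↦ restK' n a (gfrz n a b) … b (gbub x) w)| ≤ |ω_gh|·|ghWt i|·|ghWt j|·n⁻⁸·betaPrime510 4 (T_bub) (δ∕n∕2∕2)` with
`GhostBubbleRest`'s `T_bub` at `Cg := CG` (`restK'_gbub_eq` + `abs_avg_fullSum_restK_gbub_le` + §1). -/
theorem abs_avg_fullSum_restK'_gbub_gfrz_le (x : Fin 2 × Fin 2 × Fin 2 × Fin 2) (ha : 0 < a) (hGa : Decays (Ga n a) CG δG) (hδ : 0 < δ)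
    (hδa : δ ≤ deltaU 4 a / 4) (hδg : δ / n ≤ δG) :
    |∑ b ∈ (univ : Finset (Fin 4 → Fin n)).image resSite, ((n : ℝ) ^ 4)⁻¹ *
        fullSum (fun w : Pt => restK' n a (gfrz n a b) cE cΛ cR cK cQ cE₂ cJ4 cΛ₂ cR₂ cQ₂ x₀ WE WJ WΛ WR WQ ωgl ωgh lam N μ ν b
          (Sum.inr (Sum.inr (Sum.inr (Sum.inl x)))) w)| ≤
      |ωgh| * |ghWt cK cQ x.1| * |ghWt cK cQ x.2.1| * ((n : ℝ) ^ 8)⁻¹ *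
        betaPrime510 4 ((1 / 2 : ℝ) * ((1 : ℝ) * ((1 : ℝ) *
          (((1 : ℝ) * ((2 / min 2 a + CG) * (Real.exp (δ / n) + 8 / (n : ℝ) ^ 3 * Real.exp (8 * δ))) * Zl 4 (δ / n - δ / n / 2)) *
            ((1 : ℝ) * ((2 / min 2 a + CG) * (Real.exp (δ / n) + 8 / (n : ℝ) ^ 3 * Real.exp (8 * δ))) * Zl 4 (δ / n - δ / n / 2))) *
          Zl 4 (δ / n / 2 / 2)) * Zl 4 (δ / n / 2 / 2))) (δ / n / 2 / 2) := by
  simp only [restK'_gbub_eq]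
  exact abs_avg_fullSum_restK_gbub_le n a cE cΛ cR cK cQ cE₂ cJ4 cΛ₂ cR₂ cQ₂ x₀ WE WJ WΛ WR WQ ωgl ωgh lam N μ ν x ha
    (fun b v => abs_gfrz_le_of_decays n a hGa b v) hδ hδa hδg

end Fixed

/-! ## §3 The packaged (REST′) binder for the range against `RoadEndBFxRecut.d1Drift_BFx_recut` -/

section Packaged

variable {a : ℝ} {cE cΛ cR cK cQ cE₂ cJ4 cΛ₂ cR₂ cQ₂ x₀ ωgl ωgh : ℕ → ℝ} {WE WJ WΛ WR WQ : ℕ → TableR} {N : ℝ} {μ ν : Fin 4}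
  {CG δG δ : ℕ → ℝ} {CR : ℝ}

/-- [folklore] **THE (REST′) BINDER FOR THE GHOST BUBBLE RANGE OF THE ROAD END OF RECORD** — LITERALLY the `τ = Sum.inr (Sum.inr (Sum.inr (Sum.inl x)))` slice of
`RoadEndBFxRecut.d1Drift_BFx_recut`'s hypothesis `hRest` (profile `gfrz n a`, normalisation `n⁸`, every `n ≥ 2`).  Inputs, per block size `n ≥ 2`: `0 < a`; the
EXPLICIT (α)-leaf `Decays (Ga n a) (CG n) (δG n)` (B5 Prop. 1.2 content, displayed); a rate `0 < δ n ≤ δ_u(4,a)∕4` with `δ n∕n ≤ δG n`; and the DISPLAYED WEIGHT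
INEQUALITY `hCR` of `GhostBubbleRest` at `Cg := CG n` — its uniformity in `n` is the A3-gh content, NOT proved, asserted nowhere. -/
theorem hRest_gbub_recut (x : Fin 2 × Fin 2 × Fin 2 × Fin 2) (ha : 0 < a)
    (hGa : ∀ n : ℕ, 2 ≤ n → ∀ [NeZero n], Decays (Ga n a) (CG n) (δG n))
    (hδ : ∀ n, 0 < δ n) (hδa : ∀ n, δ n ≤ deltaU 4 a / 4) (hδg : ∀ n : ℕ, 2 ≤ n → δ n / n ≤ δG n)
    (hCR : ∀ n : ℕ, 2 ≤ n → |ωgh n| * |ghWt (cK n) (cQ n) x.1| * |ghWt (cK n) (cQ n) x.2.1| * ((n : ℝ) ^ 8)⁻¹ *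
        betaPrime510 4 ((1 / 2 : ℝ) * ((1 : ℝ) * ((1 : ℝ) *
          (((1 : ℝ) * ((2 / min 2 a + CG n) * (Real.exp (δ n / n) + 8 / (n : ℝ) ^ 3 * Real.exp (8 * δ n))) * Zl 4 (δ n / n - δ n / n / 2)) *
            ((1 : ℝ) * ((2 / min 2 a + CG n) * (Real.exp (δ n / n) + 8 / (n : ℝ) ^ 3 * Real.exp (8 * δ n))) * Zl 4 (δ n / n - δ n / n / 2))) *
          Zl 4 (δ n / n / 2 / 2)) * Zl 4 (δ n / n / 2 / 2))) (δ n / n / 2 / 2) ≤ CR) :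
    ∀ n : ℕ, 2 ≤ n → ∀ [NeZero n],
      |∑ b ∈ (univ : Finset (Fin 4 → Fin n)).image resSite, ((n : ℝ) ^ 4)⁻¹ *
        fullSum (fun w : Pt => restK' n a (gfrz n a b) (cE n) (cΛ n) (cR n) (cK n) (cQ n) (cE₂ n) (cJ4 n) (cΛ₂ n) (cR₂ n) (cQ₂ n) (x₀ n)
          (WE n) (WJ n) (WΛ n) (WR n) (WQ n) (ωgl n) (ωgh n) ((n : ℝ) ^ 8) N μ ν b (Sum.inr (Sum.inr (Sum.inr (Sum.inl x)))) w)| ≤ CR := by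
  intro n hn _
  exact (abs_avg_fullSum_restK'_gbub_gfrz_le n a (cE n) (cΛ n) (cR n) (cK n) (cQ n) (cE₂ n) (cJ4 n) (cΛ₂ n) (cR₂ n) (cQ₂ n) (x₀ n) (WE n) (WJ n)
    (WΛ n) (WR n) (WQ n) (ωgl n) (ωgh n) ((n : ℝ) ^ 8) N μ ν x ha (hGa n hn) (hδ n) (hδa n) (hδg n hn)).trans (hCR n hn)

end Packaged

/-! ## §4 The ghost loop weight under the END's (K) ratio and pinned normalisation -/

/-- [folklore] **THE GHOST WEIGHT PREFACTOR IS n-FREE UNDER THE END's `hω`∕`hlam`** (`lam = n⁸`): `ω_gh·cK² = −2·(ω_gl·cE²)` and `ω_gl·cE² = 2N²·n⁸` give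
`|ω_gh|·|cK|·|cK|·n⁻⁸ = 4N²` (`n ≠ 0`) — so in the displayed inequality of `hRest_gbub_recut` the words with two KIN sectors carry the constant `4N²`, and each
Q sector trades one `|cK|` for `|cQ|`; the n-dependence left is `T_bub n` and `betaPrime510` only (the A3-gh content). -/
theorem ghWeight_eq_of_hω_hlam {n : ℕ} (hn : n ≠ 0) {ωgl ωgh cE cK N : ℝ} (hω : ωgh * cK ^ 2 = -2 * (ωgl * cE ^ 2))
    (hlam : ωgl * cE ^ 2 = 2 * N ^ 2 * (n : ℝ) ^ 8) : |ωgh| * |cK| * |cK| * ((n : ℝ) ^ 8)⁻¹ = 4 * N ^ 2 := by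
  have h8 : (0 : ℝ) < (n : ℝ) ^ 8 := by positivity
  have h : |ωgh| * |cK| * |cK| = 4 * N ^ 2 * (n : ℝ) ^ 8 := by
    rw [mul_assoc, ← abs_mul, ← abs_mul, ← sq, hω, hlam, abs_of_nonpos (by nlinarith [sq_nonneg N, h8.le])]
    ring
  rw [h, mul_inv_eq_iff_eq_mul₀ h8.ne']

end Summit.QuantumFields.BalabanUV.Beta.D1BFx.GhostBubbleRestFrozen

end
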